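import Literature.Geometry.Kaehler.ComplexTorusHodgeGroupHodgeCircleProductsSplit
import Literature.Geometry.Kaehler.ComplexTorusHodgeClassesProductHodgeGroupConverse
import HarnessLib

/-!
# The Hodge ring of a product of two tori on the Hodge-circle locus: `D•(X₁ × X₂) = B•(X₁ × X₂)` and
# `D• = B•` on every `X₁^{n₁} × X₂^{n₂}` (both branches); the ring of every `X₁^N × X₂^N` is generated by the
# classes coming from the factors iff `Hom(X₁, X₂) = 0`; dimensions `Σ_{a+b=p} C(g₁,a)² C(g₂,b)²` versus `C(g₁+g₂,p)²`
# (Moonen–Zarhin 1999, §3 (3.1), Theorem, Corollary; Gordon 1997, §3 Theorem; Lange 2023, §7.3.3 Exercise (3))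

Layer `Literature/Geometry/Kaehler`, namespace `Literature.Geometry.Kaehler.ComplexTorus`; lane `lit-hodgefound` (Track 2
foundations library, Layer A1/A3 «Hodge classes of complex tori; products»), prover seat p17, generation 32, self-proposed
row g32-#6 — the HODGE-CLASS consequences of the dichotomy of g32-#1 / g32-#4 (`ComplexTorusHodgeGroupHodgeCircleProducts`,
`…ProductsSplit`: for two tori with `Hg(Xᵢ)(ℝ) = h(S¹)` the product `X₁ × X₂` is on the locus iff `Hom(X₁, X₂) ≠ 0`, and
SPLITS — `Hg(X₁ × X₂) = Hg(X₁) × Hg(X₂)` — iff `Hom(X₁, X₂) = 0`), read through the tree's torus-level Moonen–Zarhin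
(3.1) (`ComplexTorusHodgeClassesProductHodgeGroup`: `Hg(X₁ × X₂) = Hg(X₁) × Hg(X₂)` ⟹ `B•(X₁ × X₂) = B•(X₁) ⊗ B•(X₂)`,
dimension count, `D = B` transfer, powers; `…Converse`: exceptional classes on some `X₁^N × X₂^N` iff the Hodge group does
not split) and Lange's Exercise 7.3.3 (3) for `X ∼ E_τ^g` (`ComplexTorusIsogenousCMPower`:
`IsIsogenous.divisorClasses_eq_hodgeClasses_of_quadratic`, `…finrank_hodgeClasses_eq_choose_sq_of_quadratic`).
THEOREMS ONLY: no definition, no instance, no named fact (D-0026, net debt 0).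

## Sources, verbatim

* B. Moonen, Yu. Zarhin, *Hodge classes on abelian varieties of low dimension*, Math. Ann. 315 (1999) (held
  `paper:arxiv-math_9901113`), §1 (p0004 L58–L66): «Consider the following condition on the complex abelian variety `X`:
  `ℬ•(Xⁿ) = 𝒟•(Xⁿ)` for all `n`. (D) If this condition is satisfied then the Hodge conjecture is "trivially" true for
  all `Xⁿ`»; §3 (3.1) (p0006 L53–L62): «We may have that `Hg(X₁ × X₂) ≠ Hg(X₁) × Hg(X₂)` … This holds if and only if for
  some `m` and `n` the Hodge ring `ℬ•(X₁^m × X₂^n)` is not generated by the elements coming from `ℬ•(X₁^m)` and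
  `ℬ•(X₂^n)`»; §3 Theorem (p0006 L70–L77): «Let `X₁` and `X₂` be complex abelian varieties which both satisfy condition
  (D) … Then `X₁ × X₂` again satisfies (D), and either `Hom(X₁, X₂) ≠ 0` or `Hg(X₁ × X₂) = Hg(X₁) × Hg(X₂)`» [(1), for
  factors without type IV] / «(2) … `X₂` is of CM-type. Then `X₁ × X₂` again satisfies (D)»; §3 Corollary (p0007
  L80–L85): «every product of elliptic curves satisfies condition (D)».
* B. B. Gordon, *A survey of the Hodge conjecture for abelian varieties* (1997), §3 Theorem: «Let `A = E₁^{n₁} × ⋯ × E_r^{n_r}`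
  … Then … `Hg(A) = Hg(E₁) × ⋯ × Hg(E_r)`; … `ℋ(A) = 𝒟(A)` [second bullet]» and its proof («`Hdg(A) = Hdg(B) ⊗ Hdg(C)`»).
* H. Lange, *Abelian Varieties over the Complex Numbers* (2023), §7.3.3 Exercise (3) (a), (b) (p. 342): for an abelian
  variety isogenous to `Eⁿ`, `E` with complex multiplication, every Hodge class is a polynomial in divisor classes and
  `dim H^{2p}_Hodge = C(n,p)²`.
* H. Imai (1976), §3 Remarks (p. 370); A. Beauville (2014), §4 Prop. 5 / Lemma 1 (`rk Hom(A, B) = 2ab` on the locus).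

## What is proved (`X₁`, `X₂` complex tori with `Hg(Xᵢ)(ℝ) = h(S¹)`, `gᵢ = dim Xᵢ ≥ 1`)

* §1 **ONE TORUS ON THE LOCUS, EVERY `g ≥ 1` AND EVERY POWER**: `D^p(X) = H^{2p}_Hodge(X)` with `dim = C(g,p)²`, and
  `D^p(Xᴺ) = H^{2p}_Hodge(Xᴺ)`, `dim = C(Ng,p)²`, for ALL `N ≥ 1` (g31-#4 / g31-#6 had `g ≥ 2`, resp. `Ng ≥ 2`; the curve
  case comes for free from Exercise 7.3.3 (3) for `X ∼ E_τ^g`): `divisorClasses_eq_hodgeClasses_of_coe_hodgeGroup_eq_range_of_pos`,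
  `finrank_hodgeClasses_eq_choose_sq_of_coe_hodgeGroup_eq_range_of_pos`, `divisorClasses_powPeriod_eq_hodgeClasses_of_coe_hodgeGroup_eq_range_of_pos`,
  `finrank_hodgeClasses_powPeriod_eq_choose_sq_of_coe_hodgeGroup_eq_range_of_pos`.
* §2 **THE SPLIT BRANCH `Hom(X₁, X₂) = 0`: NO EXCEPTIONAL CLASSES** — `H^{2p}_Hodge(X₁ × X₂)` is the span of the cross
  products `pr₁^*γ ∧ pr₂^*δ` of Hodge classes of the factors (`hodgeClasses_prodPeriod_eq_span_cross_of_homRat_eq_bot`),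
  **`dim_ℚ H^{2p}_Hodge(X₁ × X₂) = Σ_{a+b=p} C(g₁,a)² C(g₂,b)²`** (`finrank_hodgeClasses_prodPeriod_eq_sum_of_homRat_eq_bot`;
  `p = 1`: `g₁² + g₂²`), `D^p = H^{2p}_Hodge` on `X₁ × X₂` and on every `X₁^{n₁} × X₂^{n₂}`
  (`divisorClasses_prodPeriod(_powPeriod)_eq_hodgeClasses_of_homRat_eq_bot`), `H^{2p}_Hodge(X₁^N × X₂^N) = crossSpan`
  (`hodgeClasses_prodPeriod_powPeriod_eq_crossSpan_of_homRat_eq_bot`).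
* §3 **THE OTHER BRANCH `Hom(X₁, X₂) ≠ 0`**: `X₁ × X₂` is itself on the locus, so `D^p = H^{2p}_Hodge` with
  **`dim = C(g₁+g₂,p)²`** (`divisorClasses_prodPeriod_eq_hodgeClasses_of_homRat_ne_bot`; `p = 1`: `(g₁+g₂)² = g₁² + g₂² +
  rk Hom(X₁, X₂)`, `finrank_hodgeClasses_prodPeriod_one_eq_add_finrank_homRat_of_homRat_ne_bot`), and SOME `X₁^N × X₂^N`
  carries an EXCEPTIONAL Hodge class (outside the cross span; still a divisor polynomial)
  (`exists_hodgeClasses_prodPeriod_powPeriod_not_mem_crossSpan_of_homRat_ne_bot`).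
* §4 **UNIFORMLY, FOR EVERY PRODUCT OF TWO TORI ON THE LOCUS: `D^p(X₁ × X₂) = H^{2p}_Hodge(X₁ × X₂)` AND
  `D^p(X₁^{n₁} × X₂^{n₂}) = H^{2p}_Hodge(X₁^{n₁} × X₂^{n₂})` FOR ALL `n₁, n₂ ≥ 1`** (Moonen–Zarhin's «`X₁ × X₂` again
  satisfies (D)» for these factors — `divisorClasses_prodPeriod_eq_hodgeClasses_of_coe_eq_range_of_coe_eq_range`,
  `divisorClasses_prodPeriod_powPeriod_eq_hodgeClasses_of_coe_eq_range_of_coe_eq_range`), and **THE HODGE RING OF EVERY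
  `X₁^N × X₂^N` IS GENERATED BY THE CLASSES COMING FROM `X₁^N` AND `X₂^N` ⟺ `Hom(X₁, X₂) = 0`**
  (`forall_hodgeClasses_prodPeriod_powPeriod_eq_crossSpan_iff_homRat_eq_bot`,
  `exists_hodgeClasses_prodPeriod_powPeriod_ne_crossSpan_iff_homRat_ne_bot`) — (3.1) «iff» read on the locus through
  g32-#4's dichotomy.
* §5 **CM ELLIPTIC CURVES**: `dim_ℚ H²_Hodge(E_i × E_{i√2}) = 2` (cross-generated, no exceptional classes on any power) versus
  `E_i × E_i` (the tree's `finrank_hodgeClasses_gaussianSquare`: `dim = 4`), where some power carries an exceptional class.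

## References

* [MoonenZarhin1999LowDim] B. Moonen, Yu. Zarhin, Math. Ann. 315 (1999) 711–733, §1 (D), §3 (3.1), Theorem, Corollary.
  [cite: MoonenZarhin1999LowDim, §1 (D) (p0004 L58–L66), §3 (3.1) (p0006 L53–L62), §3 Theorem (p0006 L70–L77), §3 Corollary (p0007 L80–L85)]
* [Gordon1997] B. B. Gordon, *A survey of the Hodge conjecture for abelian varieties*, §3 Theorem (second bullet) and proof.
  [cite: Gordon1997, §3 Theorem (second bullet) and its proof]
* [Lange2023AbelianVarietiesComplex] H. Lange (2023), §7.3.3 Exercise (3)(a),(b) (p. 342), §7.2.4 Exercise (5).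
  [cite: Lange2023AbelianVarietiesComplex, §7.3.3 Exercise (3)(a),(b) (p. 342)]
* [Imai1976HodgeGroups] H. Imai (1976), §2 Proposition, §3 Remarks. [cite: Imai1976HodgeGroups, §3 Remarks (p. 370)]
* [Beauville2014MaximalPicard] A. Beauville (2014), §3 Prop. 3, §4 Prop. 5 and Lemma 1. [cite: Beauville2014MaximalPicard, §4 Prop. 5 and Lemma 1]
-/

noncomputable section

open scoped Matrix Real

open Set Function Module Matrix Finset

namespace Literature.Geometry.Kaehler

namespace ComplexTorus

/-! ## §1 One torus on the Hodge-circle locus: `D = B` with `dim = C(g,p)²`, every `g ≥ 1`, every power -/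

section Locus

variable {ι : Type*} [Fintype ι] [DecidableEq ι] {E : Type*} [NormedAddCommGroup E] [NormedSpace ℂ E]
  [FiniteDimensional ℂ E] (Φ : (ι → ℝ) ≃L[ℝ] E)

omit [DecidableEq ι] in
/-- `dim_ℂ (Eᴺ) = N · dim_ℂ E`. [folklore] -/
private theorem finrank_fin_pow₃₂ (N : ℕ) : finrank ℂ (Fin N → E) = N * finrank ℂ E := by
  rw [Module.finrank_pi_fintype, Finset.sum_const, Finset.card_univ, Fintype.card_fin, smul_eq_mul]

/-- **`Hg(X)(ℝ) = h(S¹)` ⟹ `D^p(X) = H^{2p}_Hodge(X)` for every `p`, EVERY `g ≥ 1`**: `X ∼ E_τ^g` with `E_τ` CM (g31-#4) and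
Lange's Exercise 7.3.3 (3)(a) for such tori (the tree's `IsIsogenous.divisorClasses_eq_hodgeClasses_of_quadratic`; g31-#4's
`divisorClasses_eq_hodgeClasses_of_coe_hodgeGroup_eq_range` assumed `g ≥ 2`). [cite: Lange2023AbelianVarietiesComplex, §7.3.3 Exercise (3)(a) (p. 342)]
[cite: Beauville2014MaximalPicard, §3 Prop. 3] -/
theorem divisorClasses_eq_hodgeClasses_of_coe_hodgeGroup_eq_range_of_pos (hg : 0 < finrank ℂ E)
    (h : (hodgeGroup Φ : Set (SpecialLinearGroup ι ℝ)) = Set.range (hodgeCircleSL Φ)) (p : ℕ) :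
    divisorClasses Φ p = hodgeClasses Φ p := by
  obtain ⟨τ, hτ, ⟨a, b, hq⟩, hX⟩ := (coe_hodgeGroup_eq_range_iff_exists_isIsogenous_ellipticPow_quadratic Φ hg).1 h
  exact hX.divisorClasses_eq_hodgeClasses_of_quadratic Φ hτ _ hq p

/-- **… with `dim_ℚ H^{2p}_Hodge(X) = C(g,p)²`**, every `g ≥ 1` (Exercise 7.3.3 (3)(b) for `X ∼ E_τ^g`).
[cite: Lange2023AbelianVarietiesComplex, §7.3.3 Exercise (3)(b) (p. 342)] [cite: Beauville2014MaximalPicard, §4 Lemma 1 (proof)] -/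
theorem finrank_hodgeClasses_eq_choose_sq_of_coe_hodgeGroup_eq_range_of_pos (hg : 0 < finrank ℂ E)
    (h : (hodgeGroup Φ : Set (SpecialLinearGroup ι ℝ)) = Set.range (hodgeCircleSL Φ)) (p : ℕ) :
    finrank ℚ (hodgeClasses Φ p) = ((finrank ℂ E).choose p) ^ 2 := by
  obtain ⟨τ, hτ, ⟨a, b, hq⟩, hX⟩ := (coe_hodgeGroup_eq_range_iff_exists_isIsogenous_ellipticPow_quadratic Φ hg).1 h
  exact hX.finrank_hodgeClasses_eq_choose_sq_of_quadratic Φ hτ _ hq p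

/-- **… and on EVERY power: `D^p(Xᴺ) = H^{2p}_Hodge(Xᴺ)`, `N ≥ 1`** (the powers stay on the locus, g31-#6
`coe_hodgeGroup_powPeriod_eq_range_iff`; g31-#6's version assumed `Ng ≥ 2`) — `X` «satisfies condition (D)».
[cite: MoonenZarhin1999LowDim, §1 (D) (p0004 L58–L66) and §3 Corollary (p0007 L80–L85)] [cite: Lange2023AbelianVarietiesComplex, §7.3.3 Exercise (3)(a) and §7.2.4 Exercise (5)] -/
theorem divisorClasses_powPeriod_eq_hodgeClasses_of_coe_hodgeGroup_eq_range_of_pos (hg : 0 < finrank ℂ E) {N : ℕ}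
    (hN : 0 < N) (h : (hodgeGroup Φ : Set (SpecialLinearGroup ι ℝ)) = Set.range (hodgeCircleSL Φ)) (p : ℕ) :
    divisorClasses (powPeriod Φ N) p = hodgeClasses (powPeriod Φ N) p :=
  divisorClasses_eq_hodgeClasses_of_coe_hodgeGroup_eq_range_of_pos (powPeriod Φ N)
    (by rw [finrank_fin_pow₃₂]; exact Nat.mul_pos hN hg) ((coe_hodgeGroup_powPeriod_eq_range_iff Φ hg hN).2 h) p

/-- `dim_ℚ H^{2p}_Hodge(Xᴺ) = C(Ng,p)²` for every `N ≥ 1` on the locus. [cite: Lange2023AbelianVarietiesComplex, §7.3.3 Exercise (3)(b) (p. 342)] -/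
theorem finrank_hodgeClasses_powPeriod_eq_choose_sq_of_coe_hodgeGroup_eq_range_of_pos (hg : 0 < finrank ℂ E) {N : ℕ}
    (hN : 0 < N) (h : (hodgeGroup Φ : Set (SpecialLinearGroup ι ℝ)) = Set.range (hodgeCircleSL Φ)) (p : ℕ) :
    finrank ℚ (hodgeClasses (powPeriod Φ N) p) = ((N * finrank ℂ E).choose p) ^ 2 := by
  rw [← finrank_fin_pow₃₂]
  exact finrank_hodgeClasses_eq_choose_sq_of_coe_hodgeGroup_eq_range_of_pos (powPeriod Φ N)
    (by rw [finrank_fin_pow₃₂]; exact Nat.mul_pos hN hg) ((coe_hodgeGroup_powPeriod_eq_range_iff Φ hg hN).2 h) p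

end Locus

/-! ## §2 The split branch `Hom(X₁, X₂) = 0`: `B•(X₁ × X₂) = B•(X₁) ⊗ B•(X₂) = D•`, dimensions `Σ C(g₁,a)² C(g₂,b)²` -/

section Split

variable {ι₁ ι₂ : Type*} [Fintype ι₁] [Fintype ι₂] [DecidableEq ι₁] [DecidableEq ι₂]
  {E₁ E₂ : Type*} [NormedAddCommGroup E₁] [NormedSpace ℂ E₁] [NormedAddCommGroup E₂] [NormedSpace ℂ E₂]
  [FiniteDimensional ℂ E₁] [FiniteDimensional ℂ E₂]
  (Φ₁ : (ι₁ → ℝ) ≃L[ℝ] E₁) (Φ₂ : (ι₂ → ℝ) ≃L[ℝ] E₂)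

/-- On the split branch `Hg(X₁)(ℝ) × Hg(X₂)(ℝ) ⊆ Hg(X₁ × X₂)(ℝ)` (the hypothesis of the tree's (3.1) theorems).
[cite: MoonenZarhin1999LowDim, §3 (3.1) (p0006 L53–L62)] [cite: Imai1976HodgeGroups, §2 Proposition (p. 368)] -/
theorem prod_le_hodgeGroup_prodPeriod_of_coe_eq_range_of_homRat_eq_bot (hg₁ : 0 < finrank ℂ E₁) (hg₂ : 0 < finrank ℂ E₂)
    (h₁ : (hodgeGroup Φ₁ : Set (SpecialLinearGroup ι₁ ℝ)) = Set.range (hodgeCircleSL Φ₁))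
    (h₂ : (hodgeGroup Φ₂ : Set (SpecialLinearGroup ι₂ ℝ)) = Set.range (hodgeCircleSL Φ₂)) (h12 : homRat Φ₁ Φ₂ = ⊥) :
    ((hodgeGroup Φ₁).prod (hodgeGroup Φ₂)).map (blockDiag ι₁ ι₂) ≤ hodgeGroup (prodPeriod Φ₁ Φ₂) :=
  (hodgeGroup_prodPeriod_eq_map_blockDiag_of_coe_eq_range_of_homRat_eq_bot Φ₁ Φ₂ hg₁ hg₂ h₁ h₂ h12).ge

/-- **THE SPLIT BRANCH HAS NO EXCEPTIONAL HODGE CLASSES: `H^{2p}_Hodge(X₁ × X₂) = Σ_{a+b=p} pr₁^*H^{2a}_Hodge(X₁) ∧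
pr₂^*H^{2b}_Hodge(X₂)`** (the `ℚ`-span of the cross products) for two tori on the locus with `Hom(X₁, X₂) = 0`.
[cite: MoonenZarhin1999LowDim, §3 (3.1) (p0006 L53–L62)] [cite: Gordon1997, §3 Theorem (proof: "`Hdg(A) = Hdg(B) ⊗ Hdg(C)`")] -/
theorem hodgeClasses_prodPeriod_eq_span_cross_of_homRat_eq_bot (hg₁ : 0 < finrank ℂ E₁) (hg₂ : 0 < finrank ℂ E₂)
    (h₁ : (hodgeGroup Φ₁ : Set (SpecialLinearGroup ι₁ ℝ)) = Set.range (hodgeCircleSL Φ₁))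
    (h₂ : (hodgeGroup Φ₂ : Set (SpecialLinearGroup ι₂ ℝ)) = Set.range (hodgeCircleSL Φ₂)) (h12 : homRat Φ₁ Φ₂ = ⊥) (p : ℕ) :
    hodgeClasses (prodPeriod Φ₁ Φ₂) p = Submodule.span ℚ
      {x | ∃ (a b : ℕ) (h : 2 * a + 2 * b = 2 * p) (γ : E₁ [⋀^Fin (2 * a)]→L[ℝ] ℂ) (δ : E₂ [⋀^Fin (2 * b)]→L[ℝ] ℂ),
        γ ∈ hodgeClasses Φ₁ a ∧ δ ∈ hodgeClasses Φ₂ b ∧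
          x = ((γ.compContinuousLinearMap (ContinuousLinearMap.fst ℝ E₁ E₂)).wedge
            (δ.compContinuousLinearMap (ContinuousLinearMap.snd ℝ E₁ E₂))).domDomCongr (finCongr h)} :=
  hodgeClasses_prod_eq_span_cross_of_prod_le_hodgeGroup Φ₁ Φ₂
    (prod_le_hodgeGroup_prodPeriod_of_coe_eq_range_of_homRat_eq_bot Φ₁ Φ₂ hg₁ hg₂ h₁ h₂ h12) p

/-- **`dim_ℚ H^{2p}_Hodge(X₁ × X₂) = Σ_{a+b=p} C(g₁,a)² · C(g₂,b)²` ON THE SPLIT BRANCH** (the Künneth count with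
`dim H^{2a}_Hodge(Xᵢ) = C(gᵢ,a)²`). [cite: MoonenZarhin1999LowDim, §3 (3.1)] [cite: Lange2023AbelianVarietiesComplex, §7.3.3 Exercise (3)(b) (p. 342)]
[cite: Gordon1997, §3 Theorem (proof)] -/
theorem finrank_hodgeClasses_prodPeriod_eq_sum_of_homRat_eq_bot (hg₁ : 0 < finrank ℂ E₁) (hg₂ : 0 < finrank ℂ E₂)
    (h₁ : (hodgeGroup Φ₁ : Set (SpecialLinearGroup ι₁ ℝ)) = Set.range (hodgeCircleSL Φ₁))
    (h₂ : (hodgeGroup Φ₂ : Set (SpecialLinearGroup ι₂ ℝ)) = Set.range (hodgeCircleSL Φ₂)) (h12 : homRat Φ₁ Φ₂ = ⊥) (p : ℕ) :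
    finrank ℚ (hodgeClasses (prodPeriod Φ₁ Φ₂) p) =
      ∑ ab ∈ antidiagonal p, ((finrank ℂ E₁).choose ab.1) ^ 2 * ((finrank ℂ E₂).choose ab.2) ^ 2 := by
  rw [finrank_hodgeClasses_prod_eq_sum_of_prod_le_hodgeGroup Φ₁ Φ₂
    (prod_le_hodgeGroup_prodPeriod_of_coe_eq_range_of_homRat_eq_bot Φ₁ Φ₂ hg₁ hg₂ h₁ h₂ h12) p]
  exact Finset.sum_congr rfl fun ab _ ↦ by
    rw [finrank_hodgeClasses_eq_choose_sq_of_coe_hodgeGroup_eq_range_of_pos Φ₁ hg₁ h₁,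
      finrank_hodgeClasses_eq_choose_sq_of_coe_hodgeGroup_eq_range_of_pos Φ₂ hg₂ h₂]

/-- … `p = 1`: **`dim_ℚ H²_Hodge(X₁ × X₂) = g₁² + g₂²` (`= ρ(X₁) + ρ(X₂)`) on the split branch**.
[cite: MoonenZarhin1999LowDim, §3 (3.1)] [cite: Beauville2014MaximalPicard, §3 Prop. 3 (`ρ = g²` on the locus)] -/
theorem finrank_hodgeClasses_prodPeriod_one_of_homRat_eq_bot (hg₁ : 0 < finrank ℂ E₁) (hg₂ : 0 < finrank ℂ E₂)
    (h₁ : (hodgeGroup Φ₁ : Set (SpecialLinearGroup ι₁ ℝ)) = Set.range (hodgeCircleSL Φ₁))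
    (h₂ : (hodgeGroup Φ₂ : Set (SpecialLinearGroup ι₂ ℝ)) = Set.range (hodgeCircleSL Φ₂)) (h12 : homRat Φ₁ Φ₂ = ⊥) :
    finrank ℚ (hodgeClasses (prodPeriod Φ₁ Φ₂) 1) = (finrank ℂ E₁) ^ 2 + (finrank ℂ E₂) ^ 2 := by
  rw [finrank_hodgeClasses_prodPeriod_eq_sum_of_homRat_eq_bot Φ₁ Φ₂ hg₁ hg₂ h₁ h₂ h12 1, Finset.Nat.sum_antidiagonal_succ,
    Finset.Nat.antidiagonal_zero, Finset.sum_singleton]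
  simp [Nat.choose_zero_right, Nat.choose_one_right, add_comm]

/-- **`D^p(X₁ × X₂) = H^{2p}_Hodge(X₁ × X₂)` ON THE SPLIT BRANCH** (Gordon's «`Hdg(A) = Hdg(B) ⊗ Hdg(C) = Div(A)`»; §1 on
the factors). [cite: Gordon1997, §3 Theorem (second bullet) and its proof] [cite: MoonenZarhin1999LowDim, §3 (3.1) and Theorem] -/
theorem divisorClasses_prodPeriod_eq_hodgeClasses_of_homRat_eq_bot (hg₁ : 0 < finrank ℂ E₁) (hg₂ : 0 < finrank ℂ E₂)
    (h₁ : (hodgeGroup Φ₁ : Set (SpecialLinearGroup ι₁ ℝ)) = Set.range (hodgeCircleSL Φ₁))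
    (h₂ : (hodgeGroup Φ₂ : Set (SpecialLinearGroup ι₂ ℝ)) = Set.range (hodgeCircleSL Φ₂)) (h12 : homRat Φ₁ Φ₂ = ⊥) (p : ℕ) :
    divisorClasses (prodPeriod Φ₁ Φ₂) p = hodgeClasses (prodPeriod Φ₁ Φ₂) p :=
  forall_divisorClasses_prod_eq_hodgeClasses_of_prod_le_hodgeGroup Φ₁ Φ₂
    (prod_le_hodgeGroup_prodPeriod_of_coe_eq_range_of_homRat_eq_bot Φ₁ Φ₂ hg₁ hg₂ h₁ h₂ h12)
    (divisorClasses_eq_hodgeClasses_of_coe_hodgeGroup_eq_range_of_pos Φ₁ hg₁ h₁)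
    (divisorClasses_eq_hodgeClasses_of_coe_hodgeGroup_eq_range_of_pos Φ₂ hg₂ h₂) p

/-- **… AND ON EVERY `X₁^{n₁} × X₂^{n₂}`** (`n₁, n₂ ≥ 1`): `D^p = H^{2p}_Hodge` — the split pair «again satisfies (D)».
[cite: MoonenZarhin1999LowDim, §3 (3.1) and Theorem (p0006 L70–L77)] [cite: Gordon1997, §3 Theorem (second bullet)] -/
theorem divisorClasses_prodPeriod_powPeriod_eq_hodgeClasses_of_homRat_eq_bot (hg₁ : 0 < finrank ℂ E₁) (hg₂ : 0 < finrank ℂ E₂)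
    (h₁ : (hodgeGroup Φ₁ : Set (SpecialLinearGroup ι₁ ℝ)) = Set.range (hodgeCircleSL Φ₁))
    (h₂ : (hodgeGroup Φ₂ : Set (SpecialLinearGroup ι₂ ℝ)) = Set.range (hodgeCircleSL Φ₂)) (h12 : homRat Φ₁ Φ₂ = ⊥)
    {n₁ n₂ : ℕ} (hn₁ : 0 < n₁) (hn₂ : 0 < n₂) (p : ℕ) :
    divisorClasses (prodPeriod (powPeriod Φ₁ n₁) (powPeriod Φ₂ n₂)) p =
      hodgeClasses (prodPeriod (powPeriod Φ₁ n₁) (powPeriod Φ₂ n₂)) p :=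
  forall_divisorClasses_prod_pow_eq_hodgeClasses_of_prod_le_hodgeGroup Φ₁ Φ₂
    (prod_le_hodgeGroup_prodPeriod_of_coe_eq_range_of_homRat_eq_bot Φ₁ Φ₂ hg₁ hg₂ h₁ h₂ h12) hn₁ hn₂
    (divisorClasses_powPeriod_eq_hodgeClasses_of_coe_hodgeGroup_eq_range_of_pos Φ₁ hg₁ hn₁ h₁)
    (divisorClasses_powPeriod_eq_hodgeClasses_of_coe_hodgeGroup_eq_range_of_pos Φ₂ hg₂ hn₂ h₂) p

/-- **`H^{2p}_Hodge(X₁^N × X₂^N)` is spanned by the classes coming from `X₁^N` and `X₂^N`** (`N ≥ 1`) on the split branch.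
[cite: MoonenZarhin1999LowDim, §3 (3.1) (p0006 L57–L62)] -/
theorem hodgeClasses_prodPeriod_powPeriod_eq_crossSpan_of_homRat_eq_bot (hg₁ : 0 < finrank ℂ E₁) (hg₂ : 0 < finrank ℂ E₂)
    (h₁ : (hodgeGroup Φ₁ : Set (SpecialLinearGroup ι₁ ℝ)) = Set.range (hodgeCircleSL Φ₁))
    (h₂ : (hodgeGroup Φ₂ : Set (SpecialLinearGroup ι₂ ℝ)) = Set.range (hodgeCircleSL Φ₂)) (h12 : homRat Φ₁ Φ₂ = ⊥)
    {N : ℕ} (hN : 0 < N) (p : ℕ) :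
    hodgeClasses (prodPeriod (powPeriod Φ₁ N) (powPeriod Φ₂ N)) p = crossSpan Φ₁ Φ₂ N p :=
  hodgeClasses_prod_pow_eq_crossSpan_of_prod_le_hodgeGroup Φ₁ Φ₂
    (prod_le_hodgeGroup_prodPeriod_of_coe_eq_range_of_homRat_eq_bot Φ₁ Φ₂ hg₁ hg₂ h₁ h₂ h12) hN p

/-- The Künneth count on the powers of the split branch: `dim_ℚ H^{2p}_Hodge(X₁^{n₁} × X₂^{n₂}) =
Σ_{a+b=p} C(n₁g₁,a)² · C(n₂g₂,b)²`. [cite: MoonenZarhin1999LowDim, §3 (3.1)] [cite: Lange2023AbelianVarietiesComplex, §7.3.3 Exercise (3)(b)] -/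
theorem finrank_hodgeClasses_prodPeriod_powPeriod_eq_sum_of_homRat_eq_bot (hg₁ : 0 < finrank ℂ E₁) (hg₂ : 0 < finrank ℂ E₂)
    (h₁ : (hodgeGroup Φ₁ : Set (SpecialLinearGroup ι₁ ℝ)) = Set.range (hodgeCircleSL Φ₁))
    (h₂ : (hodgeGroup Φ₂ : Set (SpecialLinearGroup ι₂ ℝ)) = Set.range (hodgeCircleSL Φ₂)) (h12 : homRat Φ₁ Φ₂ = ⊥)
    {n₁ n₂ : ℕ} (hn₁ : 0 < n₁) (hn₂ : 0 < n₂) (p : ℕ) :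
    finrank ℚ (hodgeClasses (prodPeriod (powPeriod Φ₁ n₁) (powPeriod Φ₂ n₂)) p) =
      ∑ ab ∈ antidiagonal p, ((n₁ * finrank ℂ E₁).choose ab.1) ^ 2 * ((n₂ * finrank ℂ E₂).choose ab.2) ^ 2 := by
  rw [finrank_hodgeClasses_prod_pow_eq_sum_of_prod_le_hodgeGroup Φ₁ Φ₂
    (prod_le_hodgeGroup_prodPeriod_of_coe_eq_range_of_homRat_eq_bot Φ₁ Φ₂ hg₁ hg₂ h₁ h₂ h12) hn₁ hn₂ p]
  exact Finset.sum_congr rfl fun ab _ ↦ by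
    rw [finrank_hodgeClasses_powPeriod_eq_choose_sq_of_coe_hodgeGroup_eq_range_of_pos Φ₁ hg₁ hn₁ h₁,
      finrank_hodgeClasses_powPeriod_eq_choose_sq_of_coe_hodgeGroup_eq_range_of_pos Φ₂ hg₂ hn₂ h₂]

end Split

/-! ## §3 The other branch `Hom(X₁, X₂) ≠ 0`: `D = B` with `dim = C(g₁+g₂,p)²`, and exceptional classes -/

section NonSplit

variable {ι₁ ι₂ : Type*} [Fintype ι₁] [Fintype ι₂] [DecidableEq ι₁] [DecidableEq ι₂]
  {E₁ E₂ : Type*} [NormedAddCommGroup E₁] [NormedSpace ℂ E₁] [NormedAddCommGroup E₂] [NormedSpace ℂ E₂]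
  [FiniteDimensional ℂ E₁] [FiniteDimensional ℂ E₂]
  (Φ₁ : (ι₁ → ℝ) ≃L[ℝ] E₁) (Φ₂ : (ι₂ → ℝ) ≃L[ℝ] E₂)

/-- **`Hom(X₁, X₂) ≠ 0` (both factors on the locus): `D^p(X₁ × X₂) = H^{2p}_Hodge(X₁ × X₂)` of dimension `C(g₁+g₂,p)²`** —
the product is itself on the locus (g32-#1). [cite: Lange2023AbelianVarietiesComplex, §7.3.3 Exercise (3)(a),(b) (p. 342)]
[cite: Beauville2014MaximalPicard, §4 Prop. 5 and Lemma 1] -/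
theorem divisorClasses_prodPeriod_eq_hodgeClasses_of_homRat_ne_bot (hg₁ : 0 < finrank ℂ E₁) (hg₂ : 0 < finrank ℂ E₂)
    (h₁ : (hodgeGroup Φ₁ : Set (SpecialLinearGroup ι₁ ℝ)) = Set.range (hodgeCircleSL Φ₁))
    (h₂ : (hodgeGroup Φ₂ : Set (SpecialLinearGroup ι₂ ℝ)) = Set.range (hodgeCircleSL Φ₂)) (h12 : homRat Φ₁ Φ₂ ≠ ⊥) (p : ℕ) :
    divisorClasses (prodPeriod Φ₁ Φ₂) p = hodgeClasses (prodPeriod Φ₁ Φ₂) p ∧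
      finrank ℚ (hodgeClasses (prodPeriod Φ₁ Φ₂) p) = ((finrank ℂ E₁ + finrank ℂ E₂).choose p) ^ 2 :=
  divisorClasses_prodPeriod_eq_hodgeClasses_of_coe_hodgeGroup_eq_range Φ₁ Φ₂ hg₁ hg₂
    ((coe_hodgeGroup_prodPeriod_eq_range_iff_homRat_ne_bot Φ₁ Φ₂ hg₁ hg₂).2 ⟨h₁, h₂, h12⟩) p

/-- … `p = 1`: **`dim_ℚ H²_Hodge(X₁ × X₂) = (g₁ + g₂)² = g₁² + g₂² + rk Hom(X₁, X₂)`** — the excess over the Künneth count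
`g₁² + g₂²` of the split branch is exactly `rk Hom(X₁, X₂) = 2g₁g₂` (Hulek–Laface's `ρ(X₁ × X₂) = ρ(X₁) + ρ(X₂) +
rk Hom`; Beauville's equality case). [cite: Beauville2014MaximalPicard, §4 Prop. 5 and Lemma 1 (p0006)] [cite: MoonenZarhin1999LowDim, §3 (3.1)] -/
theorem finrank_hodgeClasses_prodPeriod_one_eq_add_finrank_homRat_of_homRat_ne_bot (hg₁ : 0 < finrank ℂ E₁)
    (hg₂ : 0 < finrank ℂ E₂) (h₁ : (hodgeGroup Φ₁ : Set (SpecialLinearGroup ι₁ ℝ)) = Set.range (hodgeCircleSL Φ₁))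
    (h₂ : (hodgeGroup Φ₂ : Set (SpecialLinearGroup ι₂ ℝ)) = Set.range (hodgeCircleSL Φ₂)) (h12 : homRat Φ₁ Φ₂ ≠ ⊥) :
    finrank ℚ (hodgeClasses (prodPeriod Φ₁ Φ₂) 1) =
      (finrank ℂ E₁) ^ 2 + (finrank ℂ E₂) ^ 2 + finrank ℚ (homRat Φ₁ Φ₂) := by
  have hc := (coe_hodgeGroup_prodPeriod_eq_range_iff_homRat_ne_bot Φ₁ Φ₂ hg₁ hg₂).2 ⟨h₁, h₂, h12⟩
  rw [(divisorClasses_prodPeriod_eq_hodgeClasses_of_homRat_ne_bot Φ₁ Φ₂ hg₁ hg₂ h₁ h₂ h12 1).2, Nat.choose_one_right,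
    (coe_hodgeGroup_prodPeriod_eq_range_iff_finrank_homRat_eq Φ₁ Φ₂ hg₁ hg₂).1 hc]
  ring

/-- **`Hom(X₁, X₂) ≠ 0` ⟹ SOME `X₁^N × X₂^N` CARRIES AN EXCEPTIONAL HODGE CLASS** (outside the span of the classes coming
from `X₁^N` and `X₂^N`; it is still a polynomial in divisor classes by §4) — (3.1) with `Hg(X₁ × X₂) ≠ Hg(X₁) × Hg(X₂)`
(g32-#1 / g32-#4). [cite: MoonenZarhin1999LowDim, §3 (3.1) (p0006 L53–L62)] [cite: Imai1976HodgeGroups, §3 Remarks (p. 370)] -/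
theorem exists_hodgeClasses_prodPeriod_powPeriod_not_mem_crossSpan_of_homRat_ne_bot (hg₁ : 0 < finrank ℂ E₁)
    (hg₂ : 0 < finrank ℂ E₂) (h₁ : (hodgeGroup Φ₁ : Set (SpecialLinearGroup ι₁ ℝ)) = Set.range (hodgeCircleSL Φ₁))
    (h₂ : (hodgeGroup Φ₂ : Set (SpecialLinearGroup ι₂ ℝ)) = Set.range (hodgeCircleSL Φ₂)) (h12 : homRat Φ₁ Φ₂ ≠ ⊥) :
    ∃ (N p : ℕ), 0 < N ∧ ∃ γ ∈ hodgeClasses (prodPeriod (powPeriod Φ₁ N) (powPeriod Φ₂ N)) p, γ ∉ crossSpan Φ₁ Φ₂ N p :=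
  exists_hodgeClasses_prod_pow_ne_crossSpan_of_hodgeGroup_prod_ne Φ₁ Φ₂ fun h ↦
    h12 ((hodgeGroup_prodPeriod_eq_map_blockDiag_iff_homRat_eq_bot Φ₁ Φ₂ hg₁ hg₂ h₁ h₂).1 h)

end NonSplit

/-! ## §4 Uniformly: `D = B` on `X₁ × X₂` and all `X₁^{n₁} × X₂^{n₂}`; cross-generation ⟺ `Hom(X₁, X₂) = 0` -/

section Uniform

variable {ι₁ ι₂ : Type*} [Fintype ι₁] [Fintype ι₂] [DecidableEq ι₁] [DecidableEq ι₂]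
  {E₁ E₂ : Type*} [NormedAddCommGroup E₁] [NormedSpace ℂ E₁] [NormedAddCommGroup E₂] [NormedSpace ℂ E₂]
  [FiniteDimensional ℂ E₁] [FiniteDimensional ℂ E₂]
  (Φ₁ : (ι₁ → ℝ) ≃L[ℝ] E₁) (Φ₂ : (ι₂ → ℝ) ≃L[ℝ] E₂)

omit [DecidableEq ι₁] in
/-- `dim_ℂ (Eᴺ) = N · dim_ℂ E`. [folklore] -/
private theorem finrank_fin_pow₃₃ (N : ℕ) : finrank ℂ (Fin N → E₁) = N * finrank ℂ E₁ := by
  rw [Module.finrank_pi_fintype, Finset.sum_const, Finset.card_univ, Fintype.card_fin, smul_eq_mul]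

/-- **FOR EVERY PRODUCT OF TWO TORI ON THE HODGE-CIRCLE LOCUS `D^p(X₁ × X₂) = H^{2p}_Hodge(X₁ × X₂)` for every `p`** —
both branches of the dichotomy: `Hom = 0` (§2, cross products of divisor polynomials) or `Hom ≠ 0` (§3, the product is on
the locus). Every Hodge class of `X₁ × X₂` is a rational polynomial in divisor classes.
[cite: MoonenZarhin1999LowDim, §3 Theorem (p0006 L70–L77) and Corollary (p0007 L80–L85)] [cite: Gordon1997, §3 Theorem (second bullet)]
[cite: Lange2023AbelianVarietiesComplex, §7.3.3 Exercise (3)(a)] -/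
theorem divisorClasses_prodPeriod_eq_hodgeClasses_of_coe_eq_range_of_coe_eq_range (hg₁ : 0 < finrank ℂ E₁)
    (hg₂ : 0 < finrank ℂ E₂) (h₁ : (hodgeGroup Φ₁ : Set (SpecialLinearGroup ι₁ ℝ)) = Set.range (hodgeCircleSL Φ₁))
    (h₂ : (hodgeGroup Φ₂ : Set (SpecialLinearGroup ι₂ ℝ)) = Set.range (hodgeCircleSL Φ₂)) (p : ℕ) :
    divisorClasses (prodPeriod Φ₁ Φ₂) p = hodgeClasses (prodPeriod Φ₁ Φ₂) p := by
  by_cases h12 : homRat Φ₁ Φ₂ = ⊥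
  · exact divisorClasses_prodPeriod_eq_hodgeClasses_of_homRat_eq_bot Φ₁ Φ₂ hg₁ hg₂ h₁ h₂ h12 p
  · exact (divisorClasses_prodPeriod_eq_hodgeClasses_of_homRat_ne_bot Φ₁ Φ₂ hg₁ hg₂ h₁ h₂ h12 p).1

/-- **… AND `D^p(X₁^{n₁} × X₂^{n₂}) = H^{2p}_Hodge(X₁^{n₁} × X₂^{n₂})` FOR ALL `n₁, n₂ ≥ 1`** (the powers `Xᵢ^{nᵢ}` are again
on the locus) — «`X₁ × X₂` again satisfies (D)» for two tori on the Hodge-circle locus, whatever `Hom(X₁, X₂)`.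
[cite: MoonenZarhin1999LowDim, §1 (D) (p0004 L58–L66) and §3 Theorem (p0006 L70–L77)] [cite: Gordon1997, §3 Theorem (second bullet)] -/
theorem divisorClasses_prodPeriod_powPeriod_eq_hodgeClasses_of_coe_eq_range_of_coe_eq_range (hg₁ : 0 < finrank ℂ E₁)
    (hg₂ : 0 < finrank ℂ E₂) (h₁ : (hodgeGroup Φ₁ : Set (SpecialLinearGroup ι₁ ℝ)) = Set.range (hodgeCircleSL Φ₁))
    (h₂ : (hodgeGroup Φ₂ : Set (SpecialLinearGroup ι₂ ℝ)) = Set.range (hodgeCircleSL Φ₂)) {n₁ n₂ : ℕ} (hn₁ : 0 < n₁)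
    (hn₂ : 0 < n₂) (p : ℕ) :
    divisorClasses (prodPeriod (powPeriod Φ₁ n₁) (powPeriod Φ₂ n₂)) p =
      hodgeClasses (prodPeriod (powPeriod Φ₁ n₁) (powPeriod Φ₂ n₂)) p :=
  divisorClasses_prodPeriod_eq_hodgeClasses_of_coe_eq_range_of_coe_eq_range (powPeriod Φ₁ n₁) (powPeriod Φ₂ n₂)
    (by rw [finrank_fin_pow₃₃]; exact Nat.mul_pos hn₁ hg₁)
    (by rw [Module.finrank_pi_fintype, Finset.sum_const, Finset.card_univ, Fintype.card_fin, smul_eq_mul]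
        exact Nat.mul_pos hn₂ hg₂)
    ((coe_hodgeGroup_powPeriod_eq_range_iff Φ₁ hg₁ hn₁).2 h₁) ((coe_hodgeGroup_powPeriod_eq_range_iff Φ₂ hg₂ hn₂).2 h₂) p

/-- **THE HODGE RING OF EVERY `X₁^N × X₂^N` (`N ≥ 1`) IS GENERATED BY THE CLASSES COMING FROM `X₁^N` AND `X₂^N` ⟺
`Hom(X₁, X₂) = 0`** — Moonen–Zarhin (3.1) «if and only if», for two tori on the Hodge-circle locus, through g32-#4's
dichotomy `Hg(X₁ × X₂) = Hg(X₁) × Hg(X₂)` ⟺ `Hom = 0`. [cite: MoonenZarhin1999LowDim, §3 (3.1) (p0006 L53–L62) and Theorem (1)]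
[cite: Imai1976HodgeGroups, §2 Proposition and §3 Remarks] -/
theorem forall_hodgeClasses_prodPeriod_powPeriod_eq_crossSpan_iff_homRat_eq_bot (hg₁ : 0 < finrank ℂ E₁)
    (hg₂ : 0 < finrank ℂ E₂) (h₁ : (hodgeGroup Φ₁ : Set (SpecialLinearGroup ι₁ ℝ)) = Set.range (hodgeCircleSL Φ₁))
    (h₂ : (hodgeGroup Φ₂ : Set (SpecialLinearGroup ι₂ ℝ)) = Set.range (hodgeCircleSL Φ₂)) :
    (∀ (N p : ℕ), 0 < N → hodgeClasses (prodPeriod (powPeriod Φ₁ N) (powPeriod Φ₂ N)) p = crossSpan Φ₁ Φ₂ N p) ↔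
      homRat Φ₁ Φ₂ = ⊥ := by
  rw [← hodgeGroup_prod_eq_iff_forall_hodgeClasses_prod_pow_eq_crossSpan,
    hodgeGroup_prodPeriod_eq_map_blockDiag_iff_homRat_eq_bot Φ₁ Φ₂ hg₁ hg₂ h₁ h₂]

/-- **… equivalently: SOME `X₁^N × X₂^N` carries an exceptional Hodge class ⟺ `Hom(X₁, X₂) ≠ 0`.**
[cite: MoonenZarhin1999LowDim, §3 (3.1) (p0006 L53–L62)] -/
theorem exists_hodgeClasses_prodPeriod_powPeriod_ne_crossSpan_iff_homRat_ne_bot (hg₁ : 0 < finrank ℂ E₁)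
    (hg₂ : 0 < finrank ℂ E₂) (h₁ : (hodgeGroup Φ₁ : Set (SpecialLinearGroup ι₁ ℝ)) = Set.range (hodgeCircleSL Φ₁))
    (h₂ : (hodgeGroup Φ₂ : Set (SpecialLinearGroup ι₂ ℝ)) = Set.range (hodgeCircleSL Φ₂)) :
    (∃ (N p : ℕ), 0 < N ∧ hodgeClasses (prodPeriod (powPeriod Φ₁ N) (powPeriod Φ₂ N)) p ≠ crossSpan Φ₁ Φ₂ N p) ↔
      homRat Φ₁ Φ₂ ≠ ⊥ := by
  rw [Ne, ← forall_hodgeClasses_prodPeriod_powPeriod_eq_crossSpan_iff_homRat_eq_bot Φ₁ Φ₂ hg₁ hg₂ h₁ h₂]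
  push Not
  exact Iff.rfl

end Uniform

/-! ## §5 Two elliptic curves with complex multiplication: `E_i × E_{i√2}` versus `E_i × E_i` -/

section Elliptic

/-- `0 < dim_ℂ ℂ = 1`. [folklore] -/
private theorem finrank_complex_self_pos' : 0 < finrank ℂ ℂ := by rw [Module.finrank_self]; exact one_pos

/-- **`dim_ℚ H²_Hodge(E_i × E_{i√2}) = 2`** (`= ρ`): two non-isogenous CM curves, the split branch — no exceptional classes on
any power, every Hodge class a cross product of classes of the factors. [cite: MoonenZarhin1999LowDim, §3 Corollary (p0007 L80–L85) and (3.1)]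
[cite: Imai1976HodgeGroups, §2 Proposition (p. 368)] -/
theorem finrank_hodgeClasses_prodPeriod_I_I_mul_sqrt_two_one (hI : Complex.I.im ≠ 0) (h : (Complex.I * Real.sqrt 2).im ≠ 0) :
    finrank ℚ (hodgeClasses (prodPeriod (ellipticPeriod hI) (ellipticPeriod h)) 1) = 2 := by
  obtain ⟨h₁, h₂, hbot, -⟩ := coe_hodgeGroup_prodPeriod_I_I_mul_sqrt_two_ne_range hI h
  rw [finrank_hodgeClasses_prodPeriod_one_of_homRat_eq_bot _ _ finrank_complex_self_pos' finrank_complex_self_pos' h₁ h₂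
    hbot, Module.finrank_self]
  norm_num

/-- … and all Hodge classes of all `E_i^N × E_{i√2}^N` come from the factors. [cite: MoonenZarhin1999LowDim, §3 (3.1) and Corollary] -/
theorem hodgeClasses_prodPeriod_powPeriod_I_I_mul_sqrt_two_eq_crossSpan (hI : Complex.I.im ≠ 0)
    (h : (Complex.I * Real.sqrt 2).im ≠ 0) {N : ℕ} (hN : 0 < N) (p : ℕ) :
    hodgeClasses (prodPeriod (powPeriod (ellipticPeriod hI) N) (powPeriod (ellipticPeriod h) N)) p =
      crossSpan (ellipticPeriod hI) (ellipticPeriod h) N p := by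
  obtain ⟨h₁, h₂, hbot, -⟩ := coe_hodgeGroup_prodPeriod_I_I_mul_sqrt_two_ne_range hI h
  exact hodgeClasses_prodPeriod_powPeriod_eq_crossSpan_of_homRat_eq_bot _ _ finrank_complex_self_pos'
    finrank_complex_self_pos' h₁ h₂ hbot hN p

/-- **`E_i × E_i`, the other branch: some `E_i^N × E_i^N` carries an EXCEPTIONAL Hodge class** (already `N = 1`:
`dim_ℚ H²_Hodge(E_i × E_i) = 4 = 1 + 1 + rk End(E_i)` — the tree's `finrank_hodgeClasses_gaussianSquare` — against the Künneth
count `2`; the graph classes of `ℤ[i] = End(E_i)` are not cross products). [cite: MoonenZarhin1999LowDim, §3 (3.1)]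
[cite: Imai1976HodgeGroups, §3 Remarks (p. 370)] [cite: Beauville2014MaximalPicard, §4 Prop. 5] -/
theorem exists_hodgeClasses_prodPeriod_powPeriod_I_I_not_mem_crossSpan (hI : Complex.I.im ≠ 0) :
    ∃ (N p : ℕ), 0 < N ∧ ∃ γ ∈ hodgeClasses (prodPeriod (powPeriod (ellipticPeriod hI) N) (powPeriod (ellipticPeriod hI) N)) p,
      γ ∉ crossSpan (ellipticPeriod hI) (ellipticPeriod hI) N p := by
  have h₁ := (coe_hodgeGroup_ellipticPeriod_eq_range_iff_ne_bot hI).2 (ellipticEnd_gaussian_ne_bot hI)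
  exact exists_hodgeClasses_prodPeriod_powPeriod_not_mem_crossSpan_of_homRat_ne_bot _ _ finrank_complex_self_pos'
    finrank_complex_self_pos' h₁ h₁
    ((coe_hodgeGroup_prodPeriod_eq_range_iff_homRat_ne_bot _ _ finrank_complex_self_pos' finrank_complex_self_pos').1
      (coe_hodgeGroup_prodPeriod_gaussian_eq_range hI)).2.2

end Elliptic

end ComplexTorus

end Literature.Geometry.Kaehler
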